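import Summits.AtomisticToContinuum.Crystallization.Theorems.FrustratedLawDichotomyStrainedPatchHomForceRing
import Summits.AtomisticToContinuum.Crystallization.Theorems.FrustratedLawDichotomyStrainedPatchHomCurvRegime3

/-!
# The force-annulus certificate in HESSIAN FORM: `segGd` of the Lennard-Jones force profile IS `alphaLJ·⟪X,Δ⟫² + betaLJ·‖Δ‖²`
# (bridge from a kernel force-Jacobian enclosure in hand-1's `(α, β)` currency to `…HomForceRing`; 27623 `(H)`, hcp half, ring leaf [F])

decomp-a2c hand-2 g29 (crux `AperiodicFrustratedLawGap`, stmt-AtomisticToContinuum-27623; critic row 1089: the LJ7 force-Jacobian kit is «hand-1's CurvCentre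
machinery one potential over»).  `…HomForceRing.hcpForceLJ_exterior` takes the Jacobian floor as `λ‖Δ‖² ≤ Σ_b segGd W₁ p_b Δ s` with the profile
`W₁(r) = r⁻⁷ − r⁻¹³`.  A kernel kit in the style of `…HomCurvLeafL2` / `…HomHertzKit` certifies instead the HESSIAN-FORM floor
`λ‖Δ‖² ≤ Σ_b (α_b ⟪X_b, Δ⟫² + β_b ‖Δ‖²)` with `α = alphaLJ`, `β = betaLJ` of `…HomCurvRegime3` (the pure Lennard-Jones closed forms already in the tree:
`alphaLJ ρ = 14ρ⁻¹⁶ − 8ρ⁻¹⁰ = (W₁′ − W₁/ρ)/ρ²`, `betaLJ ρ = ρ⁻⁸ − ρ⁻¹⁴ = W₁/ρ`).  This file proves the identity between the two and restates the exterior /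
slab-confinement theorems with the Hessian-form hypothesis, so the kit's soundness theorem plugs in with no calculus left to do:

* §1 `hasDerivAt_ljProfile_explicit`, `deriv_ljProfile`, `deriv_ljProfile_eq_alpha_beta`, `ljProfile_div_eq_betaLJ`;
* §2 ★ `segGd_ljProfile_eq` (`segGd W₁ p Δ s = alphaLJ ρ · ⟪p + sΔ, Δ⟫² + betaLJ ρ · ‖Δ‖²`, `ρ = ‖p + sΔ‖ ≠ 0`) and the hcp point form;
* §3 ★★★ `hcpForceLJ_exterior_of_hessForm` / `hcpForceLJ_slab_confinement_of_hessForm`.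

NO definitions; 0 sorry; standard axioms; no instances / notation / `#eval`.  `--supports stmt-AtomisticToContinuum-27623`.
-/

noncomputable section

namespace Summit.AtomisticToContinuum.Crystallization.Theorems.FrustratedLawDichotomyStrainedPatchHomForceRing

open scoped BigOperators RealInnerProductSpace
open Summit.AtomisticToContinuum.Crystallization.Theorems.FrustratedLawDichotomyStrainedPatchTaylorChord (segR segN segS segG segGd segN_eq_inner)
open Summit.AtomisticToContinuum.Crystallization.Theorems.ChargedEnergyGapNegative (E3)
open Summit.AtomisticToContinuum.Crystallization.Theorems.FrustratedLawDichotomyStrainedPatchHomSplit (latPt hexFrame hcpShift)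
open Summit.AtomisticToContinuum.Crystallization.Theorems.FrustratedLawDichotomyStrainedPatchHomLatticeBoxHcp (norm_shifted_gt)
open Summit.AtomisticToContinuum.Crystallization.Theorems.FrustratedLawDichotomyStrainedPatchHomConvexSegment (norm_shuffle_segment_le)
open Summit.AtomisticToContinuum.Crystallization.Theorems.FrustratedLawDichotomyStrainedPatchHomCurvRegime3 (alphaLJ betaLJ)

/-! ## §1. The derivative of the Lennard-Jones force profile in the `(α, β)` currency -/

/-- `W₁′(r) = 13 r⁻¹⁴ − 7 r⁻⁸` for `r ≠ 0`. [formal bookkeeping] -/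
theorem hasDerivAt_ljProfile_explicit {r : ℝ} (hr : r ≠ 0) :
    HasDerivAt (fun x : ℝ => x⁻¹ ^ 7 - x⁻¹ ^ 13) (13 * r⁻¹ ^ 14 - 7 * r⁻¹ ^ 8) r := by
  have h : HasDerivAt (fun x : ℝ => x⁻¹ ^ 7 - x⁻¹ ^ 13)
      ((7 : ℕ) * r⁻¹ ^ (7 - 1) * (-(r ^ 2)⁻¹) - (13 : ℕ) * r⁻¹ ^ (13 - 1) * (-(r ^ 2)⁻¹)) r :=
    ((hasDerivAt_inv hr).pow 7).sub ((hasDerivAt_inv hr).pow 13)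
  refine h.congr_deriv ?_
  have e2 : (r ^ 2)⁻¹ = r⁻¹ ^ 2 := by rw [inv_pow]
  rw [e2]
  push_cast
  ring

/-- `deriv W₁ r = 13 r⁻¹⁴ − 7 r⁻⁸` for `r ≠ 0`. [formal bookkeeping] -/
theorem deriv_ljProfile {r : ℝ} (hr : r ≠ 0) : deriv (fun x : ℝ => x⁻¹ ^ 7 - x⁻¹ ^ 13) r = 13 * r⁻¹ ^ 14 - 7 * r⁻¹ ^ 8 :=
  (hasDerivAt_ljProfile_explicit hr).deriv

/-- `W₁′(ρ) = alphaLJ ρ · ρ² + betaLJ ρ` (`ρ ≠ 0`). [arithmetic] -/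
theorem deriv_ljProfile_eq_alpha_beta {ρ : ℝ} (hρ : ρ ≠ 0) :
    deriv (fun x : ℝ => x⁻¹ ^ 7 - x⁻¹ ^ 13) ρ = alphaLJ ρ * ρ ^ 2 + betaLJ ρ := by
  rw [deriv_ljProfile hρ, alphaLJ, betaLJ]
  have h : ρ⁻¹ * ρ = 1 := inv_mul_cancel₀ hρ
  have e16 : ρ⁻¹ ^ 16 * ρ ^ 2 = ρ⁻¹ ^ 14 := by
    calc ρ⁻¹ ^ 16 * ρ ^ 2 = ρ⁻¹ ^ 14 * (ρ⁻¹ * ρ) ^ 2 := by ring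
      _ = ρ⁻¹ ^ 14 := by rw [h]; ring
  have e10 : ρ⁻¹ ^ 10 * ρ ^ 2 = ρ⁻¹ ^ 8 := by
    calc ρ⁻¹ ^ 10 * ρ ^ 2 = ρ⁻¹ ^ 8 * (ρ⁻¹ * ρ) ^ 2 := by ring
      _ = ρ⁻¹ ^ 8 := by rw [h]; ring
  linear_combination (-14 : ℝ) * e16 + 8 * e10

/-- `W₁(ρ)/ρ = betaLJ ρ`. [arithmetic] -/
theorem ljProfile_div_eq_betaLJ (ρ : ℝ) : (ρ⁻¹ ^ 7 - ρ⁻¹ ^ 13) / ρ = betaLJ ρ := by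
  rw [betaLJ, div_eq_mul_inv]
  ring

/-! ## §2. `segGd` of the LJ profile in Hessian form -/

/-- ★ **`segGd W₁ p Δ s = alphaLJ ρ · ⟪p + sΔ, Δ⟫² + betaLJ ρ · ‖Δ‖²`** (`ρ = ‖p + sΔ‖ ≠ 0`): the curvature-sum summand of the LJ force profile is the
quadratic form of the one-pair Hessian `alphaLJ(ρ) X Xᵀ + betaLJ(ρ) I` at `X = p + sΔ`. [folklore: `W₁′ = αρ² + β`, `W₁/ρ = β`] -/
theorem segGd_ljProfile_eq {p Δ : E3} {s : ℝ} (h : p + s • Δ ≠ 0) :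
    segGd (fun x : ℝ => x⁻¹ ^ 7 - x⁻¹ ^ 13) p Δ s =
      alphaLJ ‖p + s • Δ‖ * ⟪p + s • Δ, Δ⟫ ^ 2 + betaLJ ‖p + s • Δ‖ * ‖Δ‖ ^ 2 := by
  have hρ : ‖p + s • Δ‖ ≠ 0 := norm_ne_zero_iff.2 h
  simp only [segGd, segS, segR, segN_eq_inner]
  rw [deriv_ljProfile_eq_alpha_beta hρ]
  have hb : (‖p + s • Δ‖⁻¹ ^ 7 - ‖p + s • Δ‖⁻¹ ^ 13) = betaLJ ‖p + s • Δ‖ * ‖p + s • Δ‖ := by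
    rw [← ljProfile_div_eq_betaLJ, div_mul_cancel₀ _ hρ]
  rw [hb]
  field_simp
  ring

/-- The hcp point form: with `X_b(s) = latPt U hexFrame b + U(hcpShift + ξ₀) + s·U(ξ − ξ₀)` (never zero for `‖U − 1‖ ≤ 1/4`, `‖ξ₀‖, ‖ξ‖ ≤ 1/4`,
`s ∈ [0,1]`), `segGd W₁ p_b Δ s = alphaLJ ‖X_b(s)‖ ⟪X_b(s), Δ⟫² + betaLJ ‖X_b(s)‖ ‖Δ‖²`. [folklore chaining] -/
theorem segGd_ljProfile_hcp {U : E3 →L[ℝ] E3} (hU : ‖U - 1‖ ≤ 1 / 4) {ξ₀ ξ : E3} (hξ₀ : ‖ξ₀‖ ≤ 1 / 4) (hξ : ‖ξ‖ ≤ 1 / 4) (b : Fin 3 → ℤ)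
    {s : ℝ} (hs : s ∈ Set.Icc (0 : ℝ) 1) :
    segGd (fun x : ℝ => x⁻¹ ^ 7 - x⁻¹ ^ 13) (latPt U hexFrame b + U (hcpShift + ξ₀)) (U (ξ - ξ₀)) s =
      alphaLJ ‖latPt U hexFrame b + U (hcpShift + ξ₀) + s • U (ξ - ξ₀)‖ * ⟪latPt U hexFrame b + U (hcpShift + ξ₀) + s • U (ξ - ξ₀), U (ξ - ξ₀)⟫ ^ 2 +
        betaLJ ‖latPt U hexFrame b + U (hcpShift + ξ₀) + s • U (ξ - ξ₀)‖ * ‖U (ξ - ξ₀)‖ ^ 2 := by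
  refine segGd_ljProfile_eq ?_
  have hseg : latPt U hexFrame b + U (hcpShift + ξ₀) + s • U (ξ - ξ₀) = latPt U hexFrame b + U (hcpShift + (ξ₀ + s • (ξ - ξ₀))) := by
    simp only [map_add, map_smul]; abel
  rw [hseg]
  exact norm_pos_iff.1 (lt_trans (by norm_num) (norm_shifted_gt hU (norm_shuffle_segment_le hξ₀ hξ hs) b))

/-! ## §3. The exterior bound and the slab confinement from a HESSIAN-FORM Jacobian floor -/

/-- ★★★ **EXTERIOR FORCE BOUND, LJ `B`-FAMILY, FROM A HESSIAN-FORM JACOBIAN FLOOR.**  As `hcpForceLJ_exterior`, with the Jacobian floor stated as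
`λ‖Δ‖² ≤ Σ_b (alphaLJ ‖X_b(s)‖ ⟪X_b(s), Δ⟫² + betaLJ ‖X_b(s)‖ ‖Δ‖²)` along the segment (`X_b(s) = p_b + sΔ`) — the output currency of an
`…HomHertzKit`-style kernel test with the pure Lennard-Jones coefficients of `…HomCurvRegime3`. [folklore chaining] -/
theorem hcpForceLJ_exterior_of_hessForm (B : Finset (Fin 3 → ℤ)) {U : E3 →L[ℝ] E3} (hU : ‖U - 1‖ ≤ 1 / 4) {ξ₀ ξ : E3} (hξ₀ : ‖ξ₀‖ ≤ 1 / 4)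
    (hξ : ‖ξ‖ ≤ 1 / 4) {lam f₀ : ℝ}
    (hjac : ∀ s ∈ Set.Ioo (0 : ℝ) 1, lam * ‖U (ξ - ξ₀)‖ ^ 2 ≤
      ∑ bb ∈ B, (alphaLJ ‖latPt U hexFrame bb + U (hcpShift + ξ₀) + s • U (ξ - ξ₀)‖ *
          ⟪latPt U hexFrame bb + U (hcpShift + ξ₀) + s • U (ξ - ξ₀), U (ξ - ξ₀)⟫ ^ 2 +
        betaLJ ‖latPt U hexFrame bb + U (hcpShift + ξ₀) + s • U (ξ - ξ₀)‖ * ‖U (ξ - ξ₀)‖ ^ 2))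
    (hf₀ : |∑ bb ∈ B, (‖latPt U hexFrame bb + U (hcpShift + ξ₀)‖⁻¹ ^ 8 - ‖latPt U hexFrame bb + U (hcpShift + ξ₀)‖⁻¹ ^ 14) *
        ⟪latPt U hexFrame bb + U (hcpShift + ξ₀), U (ξ - ξ₀)⟫| ≤ f₀ * ‖U (ξ - ξ₀)‖) :
    (lam * ‖U (ξ - ξ₀)‖ - f₀) * ‖U (ξ - ξ₀)‖ ≤
      ∑ bb ∈ B, (‖latPt U hexFrame bb + U (hcpShift + ξ)‖⁻¹ ^ 8 - ‖latPt U hexFrame bb + U (hcpShift + ξ)‖⁻¹ ^ 14) *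
        ⟪latPt U hexFrame bb + U (hcpShift + ξ), U (ξ - ξ₀)⟫ := by
  refine hcpForceLJ_exterior B hU hξ₀ hξ (fun s hs => ?_) hf₀
  rw [Finset.sum_congr rfl fun bb _ => segGd_ljProfile_hcp hU hξ₀ hξ bb (Set.Ioo_subset_Icc_self hs)]
  exact hjac s hs

/-- ★★★ **SLAB CONFINEMENT `T″`, LJ `B`-FAMILY, FROM A HESSIAN-FORM JACOBIAN FLOOR** (as `hcpForceLJ_slab_confinement`). [folklore chaining] -/
theorem hcpForceLJ_slab_confinement_of_hessForm (B : Finset (Fin 3 → ℤ)) {U : E3 →L[ℝ] E3} (hU : ‖U - 1‖ ≤ 1 / 4) {ξ₀ ξ : E3}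
    (hξ₀ : ‖ξ₀‖ ≤ 1 / 4) (hξ : ‖ξ‖ ≤ 1 / 4) (hΔ : U (ξ - ξ₀) ≠ 0) {lam f₀ σ : ℝ}
    (hjac : ∀ s ∈ Set.Ioo (0 : ℝ) 1, lam * ‖U (ξ - ξ₀)‖ ^ 2 ≤
      ∑ bb ∈ B, (alphaLJ ‖latPt U hexFrame bb + U (hcpShift + ξ₀) + s • U (ξ - ξ₀)‖ *
          ⟪latPt U hexFrame bb + U (hcpShift + ξ₀) + s • U (ξ - ξ₀), U (ξ - ξ₀)⟫ ^ 2 +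
        betaLJ ‖latPt U hexFrame bb + U (hcpShift + ξ₀) + s • U (ξ - ξ₀)‖ * ‖U (ξ - ξ₀)‖ ^ 2))
    (hf₀ : |∑ bb ∈ B, (‖latPt U hexFrame bb + U (hcpShift + ξ₀)‖⁻¹ ^ 8 - ‖latPt U hexFrame bb + U (hcpShift + ξ₀)‖⁻¹ ^ 14) *
        ⟪latPt U hexFrame bb + U (hcpShift + ξ₀), U (ξ - ξ₀)⟫| ≤ f₀ * ‖U (ξ - ξ₀)‖)
    (hσ : ∑ bb ∈ B, (‖latPt U hexFrame bb + U (hcpShift + ξ)‖⁻¹ ^ 8 - ‖latPt U hexFrame bb + U (hcpShift + ξ)‖⁻¹ ^ 14) *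
        ⟪latPt U hexFrame bb + U (hcpShift + ξ), U (ξ - ξ₀)⟫ ≤ σ * ‖U (ξ - ξ₀)‖) :
    lam * ‖U (ξ - ξ₀)‖ ≤ σ + f₀ ∧ (0 ≤ lam → lam * (3 / 4 * ‖ξ - ξ₀‖) ≤ σ + f₀) := by
  refine hcpForceLJ_slab_confinement B hU hξ₀ hξ hΔ (fun s hs => ?_) hf₀ hσ
  rw [Finset.sum_congr rfl fun bb _ => segGd_ljProfile_hcp hU hξ₀ hξ bb (Set.Ioo_subset_Icc_self hs)]
  exact hjac s hs

end Summit.AtomisticToContinuum.Crystallization.Theorems.FrustratedLawDichotomyStrainedPatchHomForceRing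

end
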